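import Summits.Ventures.Crystal3D.Theorems.StickyWulffConstantGenericWallFloorStackLedgerOneSidedWide
import Summits.Ventures.Crystal3D.Theorems.StickyWulffConstantGenericWallFloorAtHalfTiltPlane
import HarnessLib

/-!
# One-sided floors with the WIDE tilt: every slot of `e₃`-component `≥ 9/20` whose rays miss the far lattice, and the word /
# orientation corollaries down to `(√3/2) sin θ ≥ 9/20` (crux `GenericWallFloor`, stmt-Ventures-19480, line `WallLedgerG`)

HONEST FRAMING. Venture `Summits/Ventures/Crystal3D` (cell `crystal3d-full`), helper `--supports` the crux `GenericWallFloor`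
of `route-Ventures-StickyWulffConstant`, REGISTERED line `WallLedgerG`, open stub `stub_twoSlabAdhesion`.  Rung credit only;
F-C1 not moved; NOT the crux (charges `< 1`; inputs `ExactOnly`(C12-55), `StarPairFar` BY NAME).
`…AtHalfTilt`/`…AtHalfTiltPlane` with the tilt `1/4 ↦ 1/3` (`twoSlabAdhesion_stackLedger_oneSided_wide`):
* `exists_tilt_vertical_wide` — every unit `v` with `⟪v,e₃⟫ ≥ 9/20` is steep for `z = (35/37)e₃ + (12/37)ŵ`, `‖z − e₃‖ ≤ 1/3`;
* `genericWallFloorAtCharge_oneSided_wide_of_far`, `genericWallFloorAtCharge_word_wide_of_inner_ge` (in-plane slot with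
  `⟪A₁u₁,e₃⟫ ≥ 9/20` ⇒ charge `(√2/2)⟪A₁u₁,e₃⟫ ≥ 0.318`), `genericWallFloorAtCharge_word_wide_of_tilted_plane` (end mirror plane with
  `(√3/2)·sin θ ≥ 9/20`, i.e. `sin θ ≥ 0.52`, ⇒ charge `(√6/4) sin θ`).
WHAT THIS IS NOT: not `c₀ = 1`; grain 2's mirror versions not here; F-C1 not moved.
-/

noncomputable section

namespace Summit.Ventures.Crystal3D.Theorems

open Summit.Ventures.Crystal3D Finset
open Literature.MathematicalPhysics.StatisticalMechanics (fccStacking barlowStacking IsHaggSeq)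
open scoped InnerProductSpace

/-- The scalar inequality behind the tilted vertical: for `9/20 ≤ s ≤ √2/2` and `n = √(1 − s²)`,
`(35 s + 12 n)/37 ≥ √2/2`. -/
theorem tilt_scalar_ineq_wide {s n : ℝ} (hs : (9 / 20 : ℝ) ≤ s) (hs1 : s ≤ Real.sqrt 2 / 2) (hn : 0 ≤ n)
    (hn2 : n ^ 2 = 1 - s ^ 2) : Real.sqrt 2 / 2 ≤ 35 / 37 * s + 12 / 37 * n := by
  obtain ⟨ht, ht'⟩ := sqrt_two_bounds
  have hsq2 : Real.sqrt 2 ^ 2 = 2 := Real.sq_sqrt (by norm_num)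
  have hs0 : 0 ≤ s := by linarith
  -- `1369 s² − 1295 √2 s + 540.5 ≤ 0` on the interval
  have hprod : 0 ≤ (s - 9 / 20) * (Real.sqrt 2 / 2 - s) := mul_nonneg (by linarith) (by linarith)
  have hlin : 1295 * Real.sqrt 2 * s ≥ 1295 * 1.41421 * s := by nlinarith
  have key : 1369 * s ^ 2 - 1295 * Real.sqrt 2 * s + 1081 / 2 ≤ 0 := by nlinarith
  by_contra hlt
  push Not at hlt
  have h1 : 12 * n < 37 * Real.sqrt 2 / 2 - 35 * s := by linarith
  have h2 : 0 ≤ 12 * n := by positivity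
  have h3 := mul_self_lt_mul_self h2 h1
  have h4 : 12 * n * (12 * n) = 144 * (1 - s ^ 2) := by rw [← hn2]; ring
  rw [h4] at h3
  nlinarith [h3, key, hsq2]

/-- **A tilted vertical.**  Every unit vector `v` with `⟪v, e₃⟫ ≥ 9/20` is steep (`⟪v, z⟫ ≥ √2/2`) for some unit
`z` with `‖z − e₃‖ ≤ 1/3` (if `v` is not already `e₃`-steep: `z = (35/37)e₃ + (12/37)ŵ`, `ŵ` the unit horizontal part
of `v`). -/
theorem exists_tilt_vertical_wide {v : EuclideanSpace ℝ (Fin 3)} (hv : ‖v‖ = 1)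
    (hs : (9 / 20 : ℝ) ≤ ⟪v, EuclideanSpace.single (2 : Fin 3) (1 : ℝ)⟫_ℝ) :
    ∃ z : EuclideanSpace ℝ (Fin 3), ‖z‖ = 1 ∧ ‖z - EuclideanSpace.single (2 : Fin 3) (1 : ℝ)‖ ≤ 1 / 3 ∧
      Real.sqrt 2 / 2 ≤ ⟪v, z⟫_ℝ := by
  by_cases hst : Real.sqrt 2 / 2 ≤ ⟪v, EuclideanSpace.single (2 : Fin 3) (1 : ℝ)⟫_ℝ
  · refine ⟨EuclideanSpace.single (2 : Fin 3) (1 : ℝ), by rw [PiLp.norm_single, norm_one], ?_, hst⟩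
    rw [sub_self, norm_zero]; norm_num
  push Not at hst
  obtain ⟨e, he⟩ : ∃ e : EuclideanSpace ℝ (Fin 3), e = EuclideanSpace.single (2 : Fin 3) (1 : ℝ) := ⟨_, rfl⟩
  rw [← he] at hs hst ⊢
  have hen : ‖e‖ = 1 := by rw [he, PiLp.norm_single, norm_one]
  obtain ⟨s, hsdef⟩ : ∃ s : ℝ, s = ⟪v, e⟫_ℝ := ⟨_, rfl⟩
  rw [← hsdef] at hs hst
  have hee : ⟪e, e⟫_ℝ = 1 := by rw [real_inner_self_eq_norm_sq, hen]; norm_num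
  have hs0 : 0 ≤ s := by linarith
  have hs1 : s ≤ Real.sqrt 2 / 2 := hst.le
  have hsq2 : Real.sqrt 2 ^ 2 = 2 := Real.sq_sqrt (by norm_num)
  -- the horizontal part of `v`
  obtain ⟨w₀, hw₀⟩ : ∃ w₀ : EuclideanSpace ℝ (Fin 3), w₀ = v - s • e := ⟨_, rfl⟩
  have hw₀e : ⟪w₀, e⟫_ℝ = 0 := by
    rw [hw₀, inner_sub_left, real_inner_smul_left, hee, hsdef]; ring
  have hew₀ : ⟪e, w₀⟫_ℝ = 0 := by rw [real_inner_comm]; exact hw₀e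
  have hvw₀ : ⟪v, w₀⟫_ℝ = 1 - s ^ 2 := by
    rw [hw₀, inner_sub_right, real_inner_smul_right, real_inner_self_eq_norm_sq, hv, ← hsdef]; ring
  have hw₀sq : ‖w₀‖ ^ 2 = 1 - s ^ 2 := by
    rw [← real_inner_self_eq_norm_sq]
    have : ⟪w₀, w₀⟫_ℝ = ⟪v, w₀⟫_ℝ - s * ⟪e, w₀⟫_ℝ := by
      have e1 : ⟪w₀, w₀⟫_ℝ = ⟪v - s • e, w₀⟫_ℝ := by rw [← hw₀]
      rw [e1, inner_sub_left, real_inner_smul_left]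
    rw [this, hvw₀, hew₀]; ring
  obtain ⟨n, hndef⟩ : ∃ n : ℝ, n = ‖w₀‖ := ⟨_, rfl⟩
  rw [← hndef] at hw₀sq
  have hn0 : 0 ≤ n := by rw [hndef]; exact norm_nonneg _
  have hnpos : 0 < n := by
    have h1 : 0 < n ^ 2 := by rw [hw₀sq]; nlinarith
    rcases hn0.lt_or_eq with h | h
    · exact h
    · rw [← h] at h1; norm_num at h1
  have hn1 : n ≠ 0 := hnpos.ne'
  -- the unit horizontal direction
  obtain ⟨w, hwdef⟩ : ∃ w : EuclideanSpace ℝ (Fin 3), w = n⁻¹ • w₀ := ⟨_, rfl⟩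
  have hwe : ⟪w, e⟫_ℝ = 0 := by rw [hwdef, real_inner_smul_left, hw₀e, mul_zero]
  have hew : ⟪e, w⟫_ℝ = 0 := by rw [real_inner_comm]; exact hwe
  have hw₀w₀ : ⟪w₀, w₀⟫_ℝ = n ^ 2 := by rw [real_inner_self_eq_norm_sq, hndef]
  have hww : ⟪w, w⟫_ℝ = 1 := by
    rw [hwdef, real_inner_smul_left, real_inner_smul_right, hw₀w₀]
    field_simp
  have hvw : ⟪v, w⟫_ℝ = n := by
    rw [hwdef, real_inner_smul_right, hvw₀, ← hw₀sq]
    field_simp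
  -- the tilted vertical
  obtain ⟨z, hzdef⟩ : ∃ z : EuclideanSpace ℝ (Fin 3), z = (35 / 37 : ℝ) • e + (12 / 37 : ℝ) • w := ⟨_, rfl⟩
  have hzz : ⟪z, z⟫_ℝ = 1 := by
    rw [hzdef]
    simp only [inner_add_left, inner_add_right, real_inner_smul_left, real_inner_smul_right, hee, hww, hwe, hew]
    norm_num
  have hz1 : ‖z‖ = 1 := by
    have h := real_inner_self_eq_norm_sq z
    rw [hzz] at h
    nlinarith [norm_nonneg z]
  have hze : ‖z - e‖ ≤ 1 / 3 := by
    have h1 : z - e = (-(2 / 37) : ℝ) • e + (12 / 37 : ℝ) • w := by rw [hzdef]; module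
    have h2 : ⟪z - e, z - e⟫_ℝ = 4 / 37 := by
      rw [h1]
      simp only [inner_add_left, inner_add_right, real_inner_smul_left, real_inner_smul_right, hee, hww, hwe, hew]
      norm_num
    have h3 := real_inner_self_eq_norm_sq (z - e)
    rw [h2] at h3
    nlinarith [norm_nonneg (z - e)]
  have hvz : ⟪v, z⟫_ℝ = 35 / 37 * s + 12 / 37 * n := by
    rw [hzdef, inner_add_right, real_inner_smul_right, real_inner_smul_right, hvw, ← hsdef]
  refine ⟨z, hz1, hze, ?_⟩
  rw [hvz]
  exact tilt_scalar_ineq_wide hs hs1 hn0 hw₀sq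


/-! ### Grain 1 alone, wide tilt -/

open scoped Classical in
/-- **Charge `½κ₁` from grain 1 alone, wide tilt** (`‖z − e₃‖ ≤ 1/3`), modulo `ExactOnly`(C12-55) and `StarPairFar`. -/
theorem genericWallFloorAtCharge_oneSided_wide_of_far
    {s₀ : EuclideanSpace ℝ (Fin 3)} (hs₀ : s₀ ∈ fccSlots)
    (hcert : ExactOnly 0 (fccSlots.filter fun w => 0 < ⟪w, s₀⟫_ℝ)) (hfar : StarPairFar)
    (A₁ : EuclideanSpace ℝ (Fin 3) ≃ₗᵢ[ℝ] EuclideanSpace ℝ (Fin 3)) (t₁ : EuclideanSpace ℝ (Fin 3))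
    (A₂ : EuclideanSpace ℝ (Fin 3) ≃ₗᵢ[ℝ] EuclideanSpace ℝ (Fin 3)) (t₂ : EuclideanSpace ℝ (Fin 3))
    {z : EuclideanSpace ℝ (Fin 3)} (hz : ‖z‖ = 1) (hze : ‖z - EuclideanSpace.single (2 : Fin 3) (1 : ℝ)‖ ≤ 1 / 3)
    {u₁ : EuclideanSpace ℝ (Fin 3)} (hu₁ : u₁ ∈ fccSlots) (hsteep₁ : Real.sqrt 2 / 2 ≤ ⟪A₁ u₁, z⟫_ℝ)
    (M₁ : Set (EuclideanSpace ℝ (Fin 3) ≃ₗᵢ[ℝ] EuclideanSpace ℝ (Fin 3)))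
    (hM₁ : ∀ stk : List WalkEntry, StackSound z stk → StackWF z stk → stk.getLast? = some ⟨A₁, u₁, 0⟩ →
      ∀ e ∈ stk, e.frame ∈ M₁)
    (hmiss : ∀ F ∈ M₁, F '' fccStacking 1 (Real.sqrt (2 / 3)) ≠ A₂ '' fccStacking 1 (Real.sqrt (2 / 3))) :
    GenericWallFloorAtCharge (Real.sqrt 2 * |⟪A₁ u₁, EuclideanSpace.single (2 : Fin 3) (1 : ℝ)⟫_ℝ| / 2) A₁ t₁ A₂ t₂ :=
  genericWallFloorAtCharge_of_ledger _ A₁ t₁ A₂ t₂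
    (twoSlabAdhesion_stackLedger_oneSided_wide hs₀ hcert (doubleStarCoaxialAt_of_starPairFar hfar)
      (capPairCoaxial_of_starPairFar hfar) A₁ t₁ A₂ t₂ hz hze hu₁ hsteep₁ M₁ hM₁ hmiss)

open scoped Classical in
/-- **Word floor, wide tilt**: chain pair `A₂·Λ₀ = (wordFrame A₁ κ)·Λ₀`, `|κ| ≥ 2`, slot `u₁` IN the first mirror plane with
`⟪A₁u₁, e₃⟫ ≥ 9/20`: `GenericWallFloorAtCharge ((√2/2)⟪A₁u₁, e₃⟫)`, modulo `ExactOnly`(C12-55) and `StarPairFar`. -/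
theorem genericWallFloorAtCharge_word_wide_of_inner_ge
    {s₀ : EuclideanSpace ℝ (Fin 3)} (hs₀ : s₀ ∈ fccSlots)
    (hcert : ExactOnly 0 (fccSlots.filter fun w => 0 < ⟪w, s₀⟫_ℝ)) (hfar : StarPairFar)
    (A₁ : EuclideanSpace ℝ (Fin 3) ≃ₗᵢ[ℝ] EuclideanSpace ℝ (Fin 3)) (t₁ : EuclideanSpace ℝ (Fin 3))
    (A₂ : EuclideanSpace ℝ (Fin 3) ≃ₗᵢ[ℝ] EuclideanSpace ℝ (Fin 3)) (t₂ : EuclideanSpace ℝ (Fin 3))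
    {u₁ : EuclideanSpace ℝ (Fin 3)} (hu₁ : u₁ ∈ fccSlots)
    (hup : (9 / 20 : ℝ) ≤ ⟪A₁ u₁, EuclideanSpace.single (2 : Fin 3) (1 : ℝ)⟫_ℝ)
    (κ : List (EuclideanSpace ℝ (Fin 3)))
    (hκl : ∀ μ ∈ κ, ‖μ‖ = 1 ∧
      ∀ w ∈ fccSlots, ⟪w, μ⟫_ℝ = 0 ∨ ⟪w, μ⟫_ℝ = Real.sqrt (2 / 3) ∨ ⟪w, μ⟫_ℝ = -Real.sqrt (2 / 3))
    (hκc : List.IsChain (fun μ μ' => ⟪μ, μ'⟫_ℝ = 1 / 3 ∨ ⟪μ, μ'⟫_ℝ = -1 / 3) κ) (hκ2 : 2 ≤ κ.length)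
    (hA₂ : A₂ '' fccStacking 1 (Real.sqrt (2 / 3)) = (wordFrame A₁ κ) '' fccStacking 1 (Real.sqrt (2 / 3)))
    (hfirst : ∀ μ, κ.getLast? = some μ → ⟪u₁, μ⟫_ℝ = 0) :
    GenericWallFloorAtCharge (Real.sqrt 2 * ⟪A₁ u₁, EuclideanSpace.single (2 : Fin 3) (1 : ℝ)⟫_ℝ / 2) A₁ t₁ A₂ t₂ := by
  obtain ⟨z, hz, hze, hsteep⟩ := exists_tilt_vertical_wide
    (by rw [LinearIsometryEquiv.norm_map, norm_eq_one_of_mem_fccSlots hu₁]) hup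
  have habs : |⟪A₁ u₁, EuclideanSpace.single (2 : Fin 3) (1 : ℝ)⟫_ℝ| = ⟪A₁ u₁, EuclideanSpace.single (2 : Fin 3) (1 : ℝ)⟫_ℝ := abs_of_nonneg (by linarith)
  have h := genericWallFloorAtCharge_oneSided_wide_of_far hs₀ hcert hfar A₁ t₁ A₂ t₂ hz hze hu₁ hsteep
    {F | ∃ stk : List WalkEntry, StackSound z stk ∧ StackWF z stk ∧ stk.getLast? = some ⟨A₁, u₁, 0⟩ ∧
      ∃ e ∈ stk, e.frame = F}
    (fun stk hS hW hlast e he => ⟨stk, hS, hW, hlast, e, he, rfl⟩)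
    (fun _ ⟨_, hS, hW, hl, _, he, hF⟩ => by rw [← hF]; exact image_ne_of_word κ hκl hκc hκ2 hA₂ hfirst hS hW hl he)
  rw [habs] at h
  exact h

open scoped Classical in
/-- **Word floor as an orientation condition, wide tilt**: end mirror plane `ν = A₁ μ` with `(√3/2)·√(1 − ⟪ν,e₃⟫²) ≥ 9/20`
⇒ `GenericWallFloorAtCharge ((√6/4)·√(1 − ⟪ν,e₃⟫²))`, modulo `ExactOnly`(C12-55) and `StarPairFar`. -/
theorem genericWallFloorAtCharge_word_wide_of_tilted_plane
    {s₀ : EuclideanSpace ℝ (Fin 3)} (hs₀ : s₀ ∈ fccSlots)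
    (hcert : ExactOnly 0 (fccSlots.filter fun w => 0 < ⟪w, s₀⟫_ℝ)) (hfar : StarPairFar)
    (A₁ : EuclideanSpace ℝ (Fin 3) ≃ₗᵢ[ℝ] EuclideanSpace ℝ (Fin 3)) (t₁ : EuclideanSpace ℝ (Fin 3))
    (A₂ : EuclideanSpace ℝ (Fin 3) ≃ₗᵢ[ℝ] EuclideanSpace ℝ (Fin 3)) (t₂ : EuclideanSpace ℝ (Fin 3))
    (κ : List (EuclideanSpace ℝ (Fin 3)))
    (hκl : ∀ μ ∈ κ, ‖μ‖ = 1 ∧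
      ∀ w ∈ fccSlots, ⟪w, μ⟫_ℝ = 0 ∨ ⟪w, μ⟫_ℝ = Real.sqrt (2 / 3) ∨ ⟪w, μ⟫_ℝ = -Real.sqrt (2 / 3))
    (hκc : List.IsChain (fun μ μ' => ⟪μ, μ'⟫_ℝ = 1 / 3 ∨ ⟪μ, μ'⟫_ℝ = -1 / 3) κ) (hκ2 : 2 ≤ κ.length)
    (hA₂ : A₂ '' fccStacking 1 (Real.sqrt (2 / 3)) = (wordFrame A₁ κ) '' fccStacking 1 (Real.sqrt (2 / 3)))
    {μ : EuclideanSpace ℝ (Fin 3)} (hμ : κ.getLast? = some μ)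
    (htilt : (9 / 20 : ℝ) ≤ Real.sqrt 3 / 2 * Real.sqrt (1 - ⟪A₁ μ, EuclideanSpace.single (2 : Fin 3) (1 : ℝ)⟫_ℝ ^ 2)) :
    GenericWallFloorAtCharge (Real.sqrt 6 / 4 * Real.sqrt (1 - ⟪A₁ μ, EuclideanSpace.single (2 : Fin 3) (1 : ℝ)⟫_ℝ ^ 2)) A₁ t₁ A₂ t₂ := by
  set e : EuclideanSpace ℝ (Fin 3) := EuclideanSpace.single (2 : Fin 3) (1 : ℝ) with he
  have hμκ := hκl μ (List.mem_of_getLast? hμ)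
  have hν : ‖A₁ μ‖ = 1 := by rw [LinearIsometryEquiv.norm_map, hμκ.1]
  have hmenu : ∀ w ∈ fccSlots, ⟪A₁ w, A₁ μ⟫_ℝ = 0 ∨ ⟪A₁ w, A₁ μ⟫_ℝ = Real.sqrt (2 / 3) ∨
      ⟪A₁ w, A₁ μ⟫_ℝ = -Real.sqrt (2 / 3) := fun w hw => by
    rw [LinearIsometryEquiv.inner_map_map]; exact hμκ.2 w hw
  have hlt : ⟪A₁ μ, e⟫_ℝ ^ 2 < 1 := by
    by_contra hge
    push Not at hge
    have : Real.sqrt (1 - ⟪A₁ μ, e⟫_ℝ ^ 2) = 0 := Real.sqrt_eq_zero'.2 (by linarith)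
    rw [this, mul_zero] at htilt
    norm_num at htilt
  obtain ⟨w, hw, hwν, hwe⟩ := exists_inPlane_slot_ge_sin A₁ hν hmenu hlt
  have hup : (9 / 20 : ℝ) ≤ ⟪A₁ w, e⟫_ℝ := htilt.trans hwe
  have hplane : ⟪w, μ⟫_ℝ = 0 := by rw [← LinearIsometryEquiv.inner_map_map A₁]; exact hwν
  have h := genericWallFloorAtCharge_word_wide_of_inner_ge hs₀ hcert hfar A₁ t₁ A₂ t₂ hw hup κ hκl hκc hκ2 hA₂
    (fun μ' hμ' => by rw [hμ] at hμ'; obtain rfl := Option.some.inj hμ'; exact hplane)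
  exact genericWallFloorAtCharge_mono (sqrt6_div_four_mul_le hwe) h

end Summit.Ventures.Crystal3D.Theorems

end
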